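import Summits.MatrixMultiplication.MatrixMultiplication.Theorems.FarEdgeDescentSpectralSublevel
import Mathlib.Algebra.MvPolynomial.Funext
import Mathlib.Algebra.MvPolynomial.Monad
import HarnessLib

/-!
# Far-edge descent, Kernel X-d — the whole support class of `⟨2,2,2⟩` is governed by the line

Support for `Summit.MatrixMultiplication.MatrixMultiplication.Theses.FarEdgeDescent`
(aside `SubLogRate`; lens «structural dichotomy (special vs generic)», generation 35).

The stratum line `q ↦ 𝔖(q)` is Bläser–Christandl–Zuiddam's one-parameter normal form of the
tensors with **the same support as `⟨2,2,2⟩`** (their Lemma 3).  This file proves that normal form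
in the tree's coordinates and pushes the special/generic dichotomy from the line to the whole
**support class** `V_S = {T : supp T ⊆ supp ⟨2,2,2⟩}` (an `8`-dimensional coordinate subspace of
`ℂ^{4×4×4}`): (§1) nowhere-zero torus scalings are mutual restrictions, so they preserve every
universal spectral value and `R̃`; (§2, `exists_scale_fam_of_sameSupport`) every `T` over any field
with `SameSupport T 𝔖(1)` is `(α ⊗ β ⊗ γ)·𝔖(q)` with `q ≠ 0` — GENERIC members of the class are
torus translates of the line, SPECIAL members (a support entry vanishes) lie in their Zariski
closure; (§3, `eval_eq_zero_of_support_subset`) over an infinite field a polynomial vanishing at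
all points with support exactly `S` vanishes on the coordinate subspace of `S`; hence (§4), by
CHNVZ's Zariski-closedness (for `R̃`, and pointwise for every universal `Φ`):
**`R̃(T) ≤ R̃(𝔖(q₀)) = r_gen ∈ [2^ω, 2^ω + 1]` and `Φ(T) ≤ Φ(𝔖(1)) + 1` for every `T ∈ V_S`**, under
`ω = 2` the whole class has `R̃ ≤ 5`, and the lens statement "every member of the line is flat" is
literally the **asymptotic rank conjecture restricted to `V_S`** (`supportClass_flat_iff_line_flat`).

## References

* M. Bläser, M. Christandl, J. Zuiddam, *The border support rank of two-by-two matrix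
  multiplication is seven*, arXiv:1705.09652 (2017), Lemma 3 (parameter reduction), Def. 5.
  [BlaserChristandlZuiddam2017]
* M. Christandl, K. Hoeberechts, H. Nieuwboer, P. Vrana, J. Zuiddam, arXiv:2411.15789, Thm. 1.2 /
  2.2, §3. [ChristandlHoeberechtsNieuwboerVranaZuiddam2025]
* V. Strassen, J. reine angew. Math. 384 (1988), §2 (restriction monotonicity). [Strassen1988]
-/

noncomputable section

open scoped BigOperators

set_option linter.dupNamespace false

namespace Summit.MatrixMultiplication.MatrixMultiplication.Theorems.FarEdgeDescentSupportClass

open Literature.Computability.AlgebraicComplexity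
open Summit.MatrixMultiplication.MatrixMultiplication.Theorems.FarEdgeDescentSignTwist
open Summit.MatrixMultiplication.MatrixMultiplication.Theorems.FarEdgeDescentSignTwistDet
open Summit.MatrixMultiplication.MatrixMultiplication.Theorems.FarEdgeDescentWeightFamily
open Summit.MatrixMultiplication.MatrixMultiplication.Theorems.FarEdgeDescentSupportStratumDoor
open Summit.MatrixMultiplication.MatrixMultiplication.Theorems.FarEdgeDescentStratumPinning
open Summit.MatrixMultiplication.MatrixMultiplication.Theorems.FarEdgeDescentGenericDomination
open Summit.MatrixMultiplication.MatrixMultiplication.Theorems.FarEdgeDescentRankOneCoupling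
open Summit.MatrixMultiplication.MatrixMultiplication.Theorems.FarEdgeDescentSpectralSublevel

/-! ## §1 Torus scalings are mutual restrictions -/

section Torus

variable {K : Type} [Field K] {ι κ μ : Type} [Fintype ι] [Fintype κ] [Fintype μ]
  [DecidableEq ι] [DecidableEq κ] [DecidableEq μ]

/-- A diagonal scaling `(α ⊗ β ⊗ γ)·t` is a restriction of `t`. [cite: Strassen1988, §2] -/
theorem restrictsTo_scale (α : ι → K) (β : κ → K) (γ : μ → K) (t : ι → κ → μ → K) :
    TensorRestrictsTo t (fun a b c => α a * β b * γ c * t a b c) := by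
  refine ⟨fun a' a => if a = a' then α a' else 0, fun b' b => if b = b' then β b' else 0,
    fun c' c => if c = c' then γ c' else 0, fun a' b' c' => ?_⟩
  rw [Finset.sum_eq_single a' (fun a _ ha => by simp [ha]) (by simp),
    Finset.sum_eq_single b' (fun b _ hb => by simp [hb]) (by simp),
    Finset.sum_eq_single c' (fun c _ hc => by simp [hc]) (by simp)]
  simp

/-- A nowhere-zero diagonal scaling is invertible: `t` is a restriction of `(α ⊗ β ⊗ γ)·t`.
[cite: Strassen1988, §2] -/
theorem scale_restrictsTo {α : ι → K} {β : κ → K} {γ : μ → K} (hα : ∀ a, α a ≠ 0)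
    (hβ : ∀ b, β b ≠ 0) (hγ : ∀ c, γ c ≠ 0) (t : ι → κ → μ → K) :
    TensorRestrictsTo (fun a b c => α a * β b * γ c * t a b c) t := by
  have h := restrictsTo_scale (fun a => (α a)⁻¹) (fun b => (β b)⁻¹) (fun c => (γ c)⁻¹)
    (fun a b c => α a * β b * γ c * t a b c)
  have ht : (fun a b c => (α a)⁻¹ * (β b)⁻¹ * (γ c)⁻¹ * (α a * β b * γ c * t a b c)) = t := by
    funext a b c
    field_simp [hα a, hβ b, hγ c]
  rwa [ht] at h

/-- **Torus invariance of spectral values**: `Φ((α ⊗ β ⊗ γ)·t) = Φ(t)` for every universal spectral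
point and nowhere-zero scalings. [cite: Strassen1988, §2] -/
theorem spectralPoint_scale_eq {F : SpectralMap K} (hF : IsUniversalSpectralPoint K F)
    {α : ι → K} {β : κ → K} {γ : μ → K} (hα : ∀ a, α a ≠ 0) (hβ : ∀ b, β b ≠ 0)
    (hγ : ∀ c, γ c ≠ 0) (t : ι → κ → μ → K) :
    F (fun a b c => α a * β b * γ c * t a b c) = F t :=
  le_antisymm (hF.mono _ _ (restrictsTo_scale α β γ t)) (hF.mono _ _ (scale_restrictsTo hα hβ hγ t))

/-- **Torus invariance of the asymptotic rank**: `R̃((α ⊗ β ⊗ γ)·t) = R̃(t)`.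
[cite: Strassen1988, Thm. 3.9] -/
theorem asymptoticRank_scale_eq {α : ι → K} {β : κ → K} {γ : μ → K} (hα : ∀ a, α a ≠ 0)
    (hβ : ∀ b, β b ≠ 0) (hγ : ∀ c, γ c ≠ 0) (t : ι → κ → μ → K) :
    asymptoticRank (fun a b c => α a * β b * γ c * t a b c) = asymptoticRank t := by
  apply le_antisymm
  · obtain ⟨F, hF, hFt⟩ :=
      (strassen_duality_asymptoticRank_holds K (fun a b c => α a * β b * γ c * t a b c)).2
    rw [← hFt, spectralPoint_scale_eq hF hα hβ hγ t]
    exact (strassen_duality_asymptoticRank_holds K t).1 F hF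
  · obtain ⟨F, hF, hFt⟩ := (strassen_duality_asymptoticRank_holds K t).2
    rw [← hFt, ← spectralPoint_scale_eq hF hα hβ hγ t]
    exact (strassen_duality_asymptoticRank_holds K _).1 F hF

end Torus

/-! ## §2 BCZ parameter reduction: the support class of `⟨2,2,2⟩` up to the torus is the line -/

section NormalForm

variable {K : Type} [Field K]

/-- Diagonal support entries of `𝔖(q)` on the coherent block are `1`. [cite: BlaserChristandlZuiddam2017, §2] -/
theorem fam_inl_diag (q : K) (i j : Fin 2) :
    fam K q (Sum.inl (i, 0)) (i, j) (Sum.inl (j, 0)) = 1 := by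
  fin_cases i <;> fin_cases j <;> simp [matMulTensor]

/-- Diagonal support entries of `𝔖(q)` on the twisted block are the weights `famW q`.
[cite: BlaserChristandlZuiddam2017, §2] -/
theorem fam_inr_diag (q : K) (i j : Fin 2) :
    fam K q (Sum.inr (i, 0)) (i, j) (Sum.inr (j, 0)) = famW K q (i, j) := by
  fin_cases i <;> fin_cases j <;> simp [matMulTensor, famW]

/-- Off the support of `𝔖(1)` every member `𝔖(q)` vanishes too. [cite: BlaserChristandlZuiddam2017, §2] -/
theorem fam_eq_zero_of_fam_one_eq_zero (q : K) {a : Leaf2} {b : Fin 2 × Fin 2} {c : Leaf2}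
    (h : fam K 1 a b c = 0) : fam K q a b c = 0 := by
  obtain ⟨b₁, b₂⟩ := b
  rcases a with ⟨i, l⟩ | ⟨i, l⟩ <;> rcases c with ⟨k, l'⟩ | ⟨k, l'⟩ <;>
    fin_cases i <;> fin_cases k <;> fin_cases b₁ <;> fin_cases b₂ <;> fin_cases l <;>
      fin_cases l' <;> simp_all [matMulTensor, famW]

/-- **Two tensors supported inside `supp 𝔖(1)` are equal once they agree on the eight support
entries** `(inl i, (i,j), inl j)` and `(inr i, (i,j), inr j)`. [cite: BlaserChristandlZuiddam2017, §2] -/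
theorem eq_of_support_of_diag {T S : Leaf2 → (Fin 2 × Fin 2) → Leaf2 → K}
    (hT : ∀ a b c, fam K 1 a b c = 0 → T a b c = 0) (hS : ∀ a b c, fam K 1 a b c = 0 → S a b c = 0)
    (hL : ∀ i j : Fin 2, T (Sum.inl (i, 0)) (i, j) (Sum.inl (j, 0)) =
      S (Sum.inl (i, 0)) (i, j) (Sum.inl (j, 0)))
    (hR : ∀ i j : Fin 2, T (Sum.inr (i, 0)) (i, j) (Sum.inr (j, 0)) =
      S (Sum.inr (i, 0)) (i, j) (Sum.inr (j, 0))) : T = S := by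
  funext a b c
  by_cases h : fam K 1 a b c = 0
  · rw [hT a b c h, hS a b c h]
  · obtain ⟨b₁, b₂⟩ := b
    rcases a with ⟨i, l⟩ | ⟨i, l⟩ <;> rcases c with ⟨k, l'⟩ | ⟨k, l'⟩ <;>
      fin_cases i <;> fin_cases k <;> fin_cases b₁ <;> fin_cases b₂ <;> fin_cases l <;>
        fin_cases l' <;> first | exact hL _ _ | exact hR _ _ | simp [matMulTensor, famW] at h

/-- **BCZ parameter reduction (Lemma 3) in tree coordinates**: a tensor with the same support as
`𝔖(1) ≅ ⟨2,2,2⟩` is a nowhere-zero torus scaling of a member `𝔖(q)`, `q ≠ 0`, of the stratum line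
(`q` is the torus invariant `(T₁₀/U₁₀)(T₀₁/U₀₁) / ((T₁₁/U₁₁)(T₀₀/U₀₀))` of the diagonal entries).
[cite: BlaserChristandlZuiddam2017, Lemma 3] -/
theorem exists_scale_fam_of_sameSupport {T : Leaf2 → (Fin 2 × Fin 2) → Leaf2 → K}
    (hT : SameSupport T (fam K 1)) :
    ∃ (α : Leaf2 → K) (β : Fin 2 × Fin 2 → K) (γ : Leaf2 → K) (q : K),
      (∀ a, α a ≠ 0) ∧ (∀ b, β b ≠ 0) ∧ (∀ c, γ c ≠ 0) ∧ q ≠ 0 ∧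
        T = fun a b c => α a * β b * γ c * fam K q a b c := by
  obtain ⟨u, hu⟩ : ∃ u : Fin 2 → Fin 2 → K,
      ∀ i j, u i j = T (Sum.inl (i, 0)) (i, j) (Sum.inl (j, 0)) := ⟨_, fun _ _ => rfl⟩
  obtain ⟨v, hv⟩ : ∃ v : Fin 2 → Fin 2 → K,
      ∀ i j, v i j = T (Sum.inr (i, 0)) (i, j) (Sum.inr (j, 0)) := ⟨_, fun _ _ => rfl⟩
  have hu0 : ∀ i j, u i j ≠ 0 := fun i j => by
    rw [hu]; exact (hT _ _ _).2 (by rw [fam_inl_diag]; exact one_ne_zero)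
  have hv0 : ∀ i j, v i j ≠ 0 := fun i j => by
    rw [hv]; exact (hT _ _ _).2 (by rw [fam_inr_diag]; simp [famW])
  have hoff : ∀ a b c, fam K 1 a b c = 0 → T a b c = 0 := fun a b c h => by
    by_contra hne
    exact (hT a b c).1 hne h
  have hu00 := hu0 0 0; have hu01 := hu0 0 1; have hu10 := hu0 1 0; have hu11 := hu0 1 1
  have hv00 := hv0 0 0; have hv01 := hv0 0 1; have hv10 := hv0 1 0; have hv11 := hv0 1 1
  refine ⟨Sum.elim (fun _ => 1)
      (fun p => if p.1 = 0 then 1 else (v 1 1 / u 1 1) / (v 0 1 / u 0 1)),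
    fun b => u b.1 b.2,
    Sum.elim (fun _ => 1) (fun p => if p.1 = 0 then v 0 0 / u 0 0 else v 0 1 / u 0 1),
    (v 1 0 / u 1 0) * (v 0 1 / u 0 1) / ((v 1 1 / u 1 1) * (v 0 0 / u 0 0)),
    ?_, ?_, ?_, ?_, ?_⟩
  · rintro (⟨i, l⟩ | ⟨i, l⟩)
    · simp
    · fin_cases i
      · simp
      · simp only [Sum.elim_inr, Fin.mk_one, one_ne_zero, if_false]
        exact div_ne_zero (div_ne_zero hv11 hu11) (div_ne_zero hv01 hu01)
  · intro b
    exact hu0 _ _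
  · rintro (⟨k, l⟩ | ⟨k, l⟩)
    · simp
    · fin_cases k
      · simpa using div_ne_zero hv00 hu00
      · simpa using div_ne_zero hv01 hu01
  · exact div_ne_zero (mul_ne_zero (div_ne_zero hv10 hu10) (div_ne_zero hv01 hu01))
      (mul_ne_zero (div_ne_zero hv11 hu11) (div_ne_zero hv00 hu00))
  · refine eq_of_support_of_diag hoff (fun a b c h => ?_) (fun i j => ?_) (fun i j => ?_)
    · rw [fam_eq_zero_of_fam_one_eq_zero _ h, mul_zero]
    · rw [← hu, fam_inl_diag]
      simp
    · rw [← hv, fam_inr_diag]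
      fin_cases i <;> fin_cases j <;> simp [famW] <;> field_simp

/-- **Exhaustion of the support class**: a tensor supported inside `supp 𝔖(1)` either has the full
support (GENERIC: a torus translate of some `𝔖(q)`, `q ≠ 0`) or vanishes at a support entry
(SPECIAL). [cite: BlaserChristandlZuiddam2017, Lemma 3] -/
theorem sameSupport_or_exists_zero {T : Leaf2 → (Fin 2 × Fin 2) → Leaf2 → K}
    (hT : ∀ a b c, fam K 1 a b c = 0 → T a b c = 0) :
    SameSupport T (fam K 1) ∨ ∃ a b c, fam K 1 a b c ≠ 0 ∧ T a b c = 0 := by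
  by_cases h : ∃ a b c, fam K 1 a b c ≠ 0 ∧ T a b c = 0
  · exact Or.inr h
  · push Not at h
    exact Or.inl fun a b c => ⟨fun hne h0 => hne (hT a b c h0), fun hne h0 => h a b c hne h0⟩

end NormalForm

/-! ## §3 Zariski density of the full-support points of a coordinate subspace -/

section Density

variable {X : Type} [Fintype X] [DecidableEq X] {K : Type} [Field K]

omit [Fintype X] [DecidableEq X] in
/-- `eval` after substituting polynomials for variables. [folklore] -/
theorem eval_bind₁ (z : X → K) (g : X → MvPolynomial X K) (p : MvPolynomial X K) :
    MvPolynomial.eval z (MvPolynomial.bind₁ g p) =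
      MvPolynomial.eval (fun x => MvPolynomial.eval z (g x)) p :=
  MvPolynomial.eval₂Hom_bind₁ (RingHom.id K) z g p

/-- **Full support is Zariski dense in a coordinate subspace** (infinite field): a polynomial that
vanishes at every point whose support is exactly `S` vanishes at every point supported inside `S`.
Proof: `p(x|_S) · ∏_{x∈S} X_x` vanishes identically, hence is `0` (`MvPolynomial.funext`), and
`∏ X_x` is not a zero divisor. [folklore] -/
theorem eval_eq_zero_of_support_subset [Infinite K] (S : Finset X) (p : MvPolynomial X K)
    (hp : ∀ y : X → K, (∀ x, y x ≠ 0 ↔ x ∈ S) → MvPolynomial.eval y p = 0)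
    (y : X → K) (hy : ∀ x, x ∉ S → y x = 0) : MvPolynomial.eval y p = 0 := by
  classical
  set g : X → MvPolynomial X K := fun x => if x ∈ S then MvPolynomial.X x else 0 with hg
  have hQ : MvPolynomial.bind₁ g p * ∏ x ∈ S, MvPolynomial.X x = 0 := by
    refine MvPolynomial.funext fun z => ?_
    rw [map_zero, map_mul, map_prod]
    by_cases hz : ∀ x ∈ S, z x ≠ 0
    · have hfun : (fun x => MvPolynomial.eval z (g x)) = fun x => if x ∈ S then z x else 0 := by
        funext x
        by_cases hx : x ∈ S <;> simp [hg, hx]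
      have h1 : MvPolynomial.eval z (MvPolynomial.bind₁ g p) =
          MvPolynomial.eval (fun x => if x ∈ S then z x else 0) p := by
        rw [eval_bind₁, hfun]
      rw [h1, hp _ fun x => ⟨fun h => by by_contra hx; simp [hx] at h,
        fun hx => by simpa [hx] using hz x hx⟩, zero_mul]
    · push Not at hz
      obtain ⟨x, hx, hzx⟩ := hz
      rw [Finset.prod_eq_zero hx (by simp [hzx]), mul_zero]
  have hprod : (∏ x ∈ S, MvPolynomial.X x : MvPolynomial X K) ≠ 0 :=
    Finset.prod_ne_zero_iff.2 fun x _ => MvPolynomial.X_ne_zero x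
  have hbind : MvPolynomial.bind₁ g p = 0 := (mul_eq_zero.1 hQ).resolve_right hprod
  have hfun : (fun x => MvPolynomial.eval y (g x)) = y := by
    funext x
    by_cases hx : x ∈ S
    · simp [hg, hx]
    · simp [hg, hx, hy x hx]
  have h2 : MvPolynomial.eval y (MvPolynomial.bind₁ g p) = MvPolynomial.eval y p := by
    rw [eval_bind₁, hfun]
  rw [← h2, hbind, map_zero]

end Density

/-! ## §4 Over `ℂ`: the support class of `⟨2,2,2⟩` is governed by the generic member of the line -/

section Complex

/-- The support of `𝔖(1) ≅ ⟨2,2,2⟩` as a finite set of coordinates. [cite: BlaserChristandlZuiddam2017, §2] -/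
def suppOne : Finset (Leaf2 × (Fin 2 × Fin 2) × Leaf2) :=
  Finset.univ.filter fun x => fam ℂ 1 x.1 x.2.1 x.2.2 ≠ 0

/-- Membership in `suppOne` is non-vanishing of the `𝔖(1)` entry. [cite: BlaserChristandlZuiddam2017, §2] -/
theorem mem_suppOne (x : Leaf2 × (Fin 2 × Fin 2) × Leaf2) :
    x ∈ suppOne ↔ fam ℂ 1 x.1 x.2.1 x.2.2 ≠ 0 := by
  simp [suppOne]

/-- **Zariski transfer from the full-support members to the support class**: a polynomial in the
`4 × 4 × 4` entries vanishing at every tensor with the same support as `𝔖(1)` vanishes at every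
tensor supported inside `supp 𝔖(1)`. [cite: ChristandlHoeberechtsNieuwboerVranaZuiddam2025, §2.2] -/
theorem eval_eq_zero_of_support {p : MvPolynomial (Leaf2 × (Fin 2 × Fin 2) × Leaf2) ℂ}
    (hp : ∀ T' : Leaf2 → (Fin 2 × Fin 2) → Leaf2 → ℂ, SameSupport T' (fam ℂ 1) →
      MvPolynomial.eval (tensorEntries T') p = 0)
    {T : Leaf2 → (Fin 2 × Fin 2) → Leaf2 → ℂ} (hT : ∀ a b c, fam ℂ 1 a b c = 0 → T a b c = 0) :
    MvPolynomial.eval (tensorEntries T) p = 0 := by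
  have hsub : ∀ x, x ∉ suppOne → tensorEntries T x = 0 := fun x hx =>
    hT _ _ _ (by by_contra hne; exact hx ((mem_suppOne x).2 hne))
  refine eval_eq_zero_of_support_subset suppOne p (fun y hy => ?_) (tensorEntries T) hsub
  have hfull : SameSupport (fun a b c => y (a, b, c)) (fam ℂ 1) := fun a b c =>
    show y (a, b, c) ≠ 0 ↔ fam ℂ 1 a b c ≠ 0 from (hy (a, b, c)).trans (mem_suppOne (a, b, c))
  have hte : tensorEntries (fun a b c => y (a, b, c)) = y := funext fun x => rfl
  have h := hp _ hfull
  rwa [hte] at h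

/-- **The support class is dominated by the generic member of the line**: for a dominant `q₀`,
every `T` with `supp T ⊆ supp 𝔖(1)` has `R̃(T) ≤ R̃(𝔖(q₀)) = r_gen`.
[cite: ChristandlHoeberechtsNieuwboerVranaZuiddam2025, Thm. 1.2; BlaserChristandlZuiddam2017, Lemma 3] -/
theorem asymptoticRank_le_dominant_of_support {q₀ : ℂ}
    (hq₀ : ∀ q, asymptoticRank (fam ℂ q) ≤ asymptoticRank (fam ℂ q₀))
    {T : Leaf2 → (Fin 2 × Fin 2) → Leaf2 → ℂ} (hT : ∀ a b c, fam ℂ 1 a b c = 0 → T a b c = 0) :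
    asymptoticRank T ≤ asymptoticRank (fam ℂ q₀) := by
  refine chnvz_zariskiClosed_asymptoticRank_le_holds ℂ Leaf2 (Fin 2 × Fin 2) Leaf2 _ T
    fun p hp => eval_eq_zero_of_support (fun T' hT' => hp T' ?_) hT
  obtain ⟨α, β, γ, q, hα, hβ, hγ, -, hEq⟩ := exists_scale_fam_of_sameSupport hT'
  rw [hEq, asymptoticRank_scale_eq hα hβ hγ]
  exact hq₀ q

/-- **Pointwise version**: for every universal spectral point `Φ` and a `Φ`-dominant member `q_Φ`,
`Φ(T) ≤ Φ(𝔖(q_Φ))` for every `T` supported inside `supp 𝔖(1)`.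
[cite: ChristandlHoeberechtsNieuwboerVranaZuiddam2025, §3; BlaserChristandlZuiddam2017, Lemma 3] -/
theorem spectralPoint_le_dominant_of_support {Φ : SpectralMap ℂ} (hΦ : IsUniversalSpectralPoint ℂ Φ)
    {q₀ : ℂ} (hq₀ : ∀ q, Φ (fam ℂ q) ≤ Φ (fam ℂ q₀))
    {T : Leaf2 → (Fin 2 × Fin 2) → Leaf2 → ℂ} (hT : ∀ a b c, fam ℂ 1 a b c = 0 → T a b c = 0) :
    Φ T ≤ Φ (fam ℂ q₀) := by
  refine spectralPoint_le_of_zariski_sublevel hΦ _ T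
    fun p hp => eval_eq_zero_of_support (fun T' hT' => hp T' ?_) hT
  obtain ⟨α, β, γ, q, hα, hβ, hγ, -, hEq⟩ := exists_scale_fam_of_sameSupport hT'
  rw [hEq, spectralPoint_scale_eq hΦ hα hβ hγ]
  exact hq₀ q

/-- **`sup_{V_S} R̃ = r_gen`, as an equivalence of level statements**: a bound `r` holds for the
asymptotic rank of every tensor supported inside `supp 𝔖(1)` iff it holds along the line.
[cite: ChristandlHoeberechtsNieuwboerVranaZuiddam2025, Thm. 1.2; BlaserChristandlZuiddam2017, Lemma 3] -/
theorem forall_support_le_iff_forall_fam_le (r : ℝ) :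
    (∀ T : Leaf2 → (Fin 2 × Fin 2) → Leaf2 → ℂ, (∀ a b c, fam ℂ 1 a b c = 0 → T a b c = 0) →
        asymptoticRank T ≤ r) ↔ ∀ q, asymptoticRank (fam ℂ q) ≤ r := by
  refine ⟨fun h q => h _ fun _ _ _ h0 => fam_eq_zero_of_fam_one_eq_zero q h0, fun h T hT => ?_⟩
  obtain ⟨q₀, hq₀⟩ := exists_dominant_fam
  exact (asymptoticRank_le_dominant_of_support hq₀ hT).trans (h q₀)

/-- **Unconditional ceiling for the support class**: every `4 × 4 × 4` tensor supported inside
`supp ⟨2,2,2⟩` (in twisted coordinates) has `R̃ ≤ 2^ω + 1`.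
[cite: ChristandlHoeberechtsNieuwboerVranaZuiddam2025, Thm. 1.2; BlaserChristandlZuiddam2017, Lemma 3; Strassen1988, Thm. 3.9] -/
theorem asymptoticRank_le_rpow_omega_add_one_of_support
    {T : Leaf2 → (Fin 2 × Fin 2) → Leaf2 → ℂ} (hT : ∀ a b c, fam ℂ 1 a b c = 0 → T a b c = 0) :
    asymptoticRank T ≤ (2 : ℝ) ^ omega ℂ + 1 := by
  obtain ⟨q₀, hq₀⟩ := exists_dominant_fam
  exact (asymptoticRank_le_dominant_of_support hq₀ hT).trans (asymptoticRank_fam_le_rpow_omega_add_one q₀)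

/-- **Pointwise ceiling**: `Φ(T) ≤ Φ(𝔖(1)) + 1` for every universal spectral point `Φ` and every `T`
supported inside `supp 𝔖(1)`. [cite: ChristandlHoeberechtsNieuwboerVranaZuiddam2025, §3; Strassen1988, §2] -/
theorem spectralPoint_le_fam_one_add_one_of_support {Φ : SpectralMap ℂ}
    (hΦ : IsUniversalSpectralPoint ℂ Φ) {T : Leaf2 → (Fin 2 × Fin 2) → Leaf2 → ℂ}
    (hT : ∀ a b c, fam ℂ 1 a b c = 0 → T a b c = 0) : Φ T ≤ Φ (fam ℂ 1) + 1 := by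
  obtain ⟨q₀, hq₀⟩ := exists_spectral_dominant_fam hΦ
  exact (spectralPoint_le_dominant_of_support hΦ hq₀ hT).trans (spectral_generic_window hΦ hq₀).2

/-- **Under the summit the whole support class has `R̃ ≤ 5`.** [conditional: MatrixMultiplication] -/
theorem asymptoticRank_le_five_of_summit_of_support (hS : _root_.MatrixMultiplication)
    {T : Leaf2 → (Fin 2 × Fin 2) → Leaf2 → ℂ} (hT : ∀ a b c, fam ℂ 1 a b c = 0 → T a b c = 0) :
    asymptoticRank T ≤ 5 := by
  obtain ⟨q₀, hq₀⟩ := exists_dominant_fam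
  exact (asymptoticRank_le_dominant_of_support hq₀ hT).trans (asymptoticRank_fam_le_five_of_summit hS q₀)

/-- **Under the summit, pointwise**: `Φ(T) ≤ 5` for every universal `Φ` on the support class.
[conditional: MatrixMultiplication] -/
theorem spectralPoint_le_five_of_summit_of_support (hS : _root_.MatrixMultiplication)
    {Φ : SpectralMap ℂ} (hΦ : IsUniversalSpectralPoint ℂ Φ)
    {T : Leaf2 → (Fin 2 × Fin 2) → Leaf2 → ℂ} (hT : ∀ a b c, fam ℂ 1 a b c = 0 → T a b c = 0) :
    Φ T ≤ 5 := by
  have h := spectralPoint_le_fam_one_add_one_of_support hΦ hT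
  rw [spectralPoint_fam_one_eq_four_of_summit hS hΦ] at h
  linarith

/-- **The lens statement is the asymptotic rank conjecture on the support class**: "every member of
the line is flat" iff "every tensor supported inside `supp ⟨2,2,2⟩` has `R̃ ≤ 4`"; either implies
`ω = 2`. [cite: ChristandlHoeberechtsNieuwboerVranaZuiddam2025, Thm. 1.2; BlaserChristandlZuiddam2017, Lemma 3] -/
theorem supportClass_flat_iff_line_flat :
    (∀ T : Leaf2 → (Fin 2 × Fin 2) → Leaf2 → ℂ, (∀ a b c, fam ℂ 1 a b c = 0 → T a b c = 0) →
        asymptoticRank T ≤ 4) ↔ ∀ q, asymptoticRank (fam ℂ q) ≤ 4 :=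
  forall_support_le_iff_forall_fam_le 4

/-- … and the flat alternative gives the summit. [cite: BlaserChristandlZuiddam2017, Lemma 3] -/
theorem summit_of_supportClass_flat
    (h : ∀ T : Leaf2 → (Fin 2 × Fin 2) → Leaf2 → ℂ, (∀ a b c, fam ℂ 1 a b c = 0 → T a b c = 0) →
      asymptoticRank T ≤ 4) : _root_.MatrixMultiplication :=
  summit_of_asymptoticRank_fam_le_four one_ne_zero
    (h _ fun _ _ _ h0 => fam_eq_zero_of_fam_one_eq_zero 1 h0)

/-- **Support-class dichotomy under the summit**: either every tensor supported inside
`supp ⟨2,2,2⟩` has `R̃ ≤ 4` (ARC holds on `V_S`), or the flat members of the line form a finite set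
containing `1` while the whole class still has `R̃ ≤ 5`. [conditional: MatrixMultiplication] -/
theorem supportClass_summit_dichotomy (hS : _root_.MatrixMultiplication) :
    (∀ T : Leaf2 → (Fin 2 × Fin 2) → Leaf2 → ℂ, (∀ a b c, fam ℂ 1 a b c = 0 → T a b c = 0) →
        asymptoticRank T ≤ 4) ∨
      ({q : ℂ | asymptoticRank (fam ℂ q) ≤ 4}.Finite ∧ (1 : ℂ) ∈ {q : ℂ | asymptoticRank (fam ℂ q) ≤ 4} ∧
        ∀ T : Leaf2 → (Fin 2 × Fin 2) → Leaf2 → ℂ, (∀ a b c, fam ℂ 1 a b c = 0 → T a b c = 0) →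
          asymptoticRank T ≤ 5) := by
  rcases summit_dichotomy hS with h | ⟨hfin, h1, -⟩
  · exact Or.inl (supportClass_flat_iff_line_flat.2 h)
  · exact Or.inr ⟨hfin, h1, fun T hT => asymptoticRank_le_five_of_summit_of_support hS hT⟩

end Complex

end Summit.MatrixMultiplication.MatrixMultiplication.Theorems.FarEdgeDescentSupportClass

end
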